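import Summits.QuantumFields.BalabanUV.T4Continuum.Support.NE7K1LinBoxCovEnergy

/-!
# NE7K1LinLineLaplacian — row NE7 (node U5), candidate route HOM, path H1L, cell K1-lin(s): card §3y STEP 7, PART 1 —
# THE LINE LAPLACIAN: `twoCutoffLine(n, a, s) = n²·lineLap(L, R′, s) + (a∕n^{d+1})·1_{same n-block}` WITH `lineLap` MESH-FREE

Lineage `b2b-balaban-t4-ne7-p2` (CRUX PROVER NE7 #2), generation 79; file 94.  Card `K1LIN-LINE.md` v1.21 §3y STEP 7 («B4 THEOREM
(1.9)∕(1.10)'s REGULARITY HALF … FOR THE LINE AT A = 0: … the line analogue would follow the same … route» as b04's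
`B4Thm110ZeroBox`, i.e. the print's (2.34) [Balaban1983RegularityDecay p. 582], whose scale-`j` operators are RESCALED COPIES of the
one-scale box operator, `B4Thm110ZeroBox.fineOp_eq_submatrix`).  For the two-cutoff line the same is true; the algebra behind it:

* §1 `sameBlk n R` (the indicator `1[blk_n x′ = blk_n x]`) and **`fineOpR_scale`**: `fineOpR (n·m) a 0 R = n²·fineOpR m 0 0 R +
  (a∕(nm)^{d+1})·sameBlk (nm) R` (Bałaban's `−Δ^η + aQ^*Q` at `A = 0` is the rescaled pure Neumann Laplacian plus the averaging term).
* §2 the block column sums of the coordinate matrix `T` of `NE7K1LinBlockCoords`: `Σ_j T(rchart b′ j, inl b) = L^{d+1}·[b′ = b]` and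
  `Σ_j T(rchart b′ j, inr (b, ν)) = 0` — THE FLUCTUATION COLUMNS HAVE ZERO BLOCK SUMS (`sum_coordT_rchart_inl ∕ _inr`).
* §3 **`coordT_sameBlk_coordT`**: `Tᵀ·sameBlk (nL) R′·T = L^{2(d+1)}·fromBlocks (sameBlk n R) 0 0 0` — run B's averaging term
  `aQ_{nL}^*Q_{nL}`, written in block coordinates, lives on the block means alone and IS run A's averaging term.
* §4 **`runA_eq`**, **`runB_eq`**: `P_A(n, a) = n²·P_A(1, 0) + (a∕n^{d+1})·sameBlk n R` and
  `H_B(n, a) = n²·H_B(1, 0) + fromBlocks ((a∕n^{d+1})·sameBlk n R) 0 0 0`.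
* §5 **`lineLap hR′L s := twoCutoffLine hR′L 1 0 s`** — the LINE LAPLACIAN `(1−s)(−Δ^N_R) + s·L^{1−d}·Schur_ψ(Tᵀ(−Δ^N_{R′})T)` (the
  `s`-interpolation of run A's Neumann Laplacian and the hard block-mean Schur complement `K_L` of run B's, NO averaging term, mesh 1) —
  and **`twoCutoffLine_eq_lineLap`**: for `n ≥ 1`, `R′` a union of `nL`-blocks, every `a, s`:
  `twoCutoffLine(n, a, s) = n²·lineLap(s) + (a∕n^{d+1})·sameBlk n R` (the averaging term passes through the Schur complement
  ADDITIVELY because it has no fluctuation components; `(c·D)⁻¹ = c⁻¹·D⁻¹` on the invertible fluctuation block, file 33's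
  `isUnit_det_runB_fluct` at `a = 0`); `lineLap_congr` (transport along an equality of fine regions).
* §6 on b04's box index: **`boxLap L hn M s`** (the reindexed `lineLap` of the Neumann box) and **`boxLine_eq_boxLap`**:
  `boxLine L hn M a s = n²·boxLap L hn M s + a·Pmat n (n·M)` (b04's block projection `B4Thm110ZeroBox.Pmat`); `boxLap_apply_congr`
  (the entries depend only on the lattice points and on the fine box AS A SET — the lever for `s_j²·boxLine(L^j, a_j, s)` in file 95).

HONEST FRAMING: [folklore]; finite block algebra over the tree's objects (`fineOpR`, `coordT`, `runA`, `runB`, `twoCutoffLine`, `boxLine`);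
nothing of Bałaban's asserted; no `sorry`.  Census only (STEP 7, part 1); NE7 NOT PRINTED ∕ NOT PROVED; spine 0∕9; FIXED FINITE T⁴,
rung (B)+1; NOT infinite volume, NOT mass gap, NOT Clay.  HONEST DEPENDENCY: continuum YM on T⁴ ⇐ BetaPertH ∧ nine spine estimates
(0/9 proved); BetaPertH ⇐ (D1) ∧ (D4) ∧ CAP+tail; G-an2-4 gates asym, D1 and NE2/3/4.
-/

noncomputable section

open Finset Matrix

namespace Summit.QuantumFields.BalabanUV.T4Continuum.NE7K1LinLineLaplacian

open Literature.MathematicalPhysics.QuantumFieldTheory.Balaban1983to89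
open Literature.MathematicalPhysics.QuantumFieldTheory.Balaban1983to89.B4Reflection242
open Literature.MathematicalPhysics.QuantumFieldTheory.Balaban1983to89.B4Lower18
open Literature.MathematicalPhysics.QuantumFieldTheory.Balaban1983to89.B4BoxCov237
open Literature.MathematicalPhysics.QuantumFieldTheory.Balaban1983to89.B4Thm110ZeroBox (blk_blk Pmat)
open NE7K1LinSchurLineForm NE7K1LinBlockCoords NE7K1LinSchurLineU1 NE7K1LinBoxCovEnergy NE7K1LinSchurFoldBox
open NE7K1LinTwoRunMonotone (twoCutoffLine_isSymm)
open NE7K1LinTorusChart (isUnit_det_runB_fluct)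

variable {d : ℕ}

/-! ### §1 The same-block indicator and the scaling of Bałaban's `A = 0` operator -/

section SameBlk

/-- the same-block indicator `1[blk_n x′ = blk_n x]` on a finite region (b04's `avgK 1 n` as a matrix). [folklore] -/
def sameBlk (n : ℕ) (R : Finset (Fin (d + 1) → ℤ)) : Matrix ↥R ↥R ℝ :=
  Matrix.of fun x x' => if blk n x'.1 = blk n x.1 then 1 else 0

/-- `sameBlk` is symmetric. [folklore] -/
theorem sameBlk_isSymm (n : ℕ) (R : Finset (Fin (d + 1) → ℤ)) : (sameBlk n R).IsSymm := by
  ext x y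
  simp only [sameBlk, Matrix.transpose_apply, Matrix.of_apply, eq_comm]

/-- **SCALING OF BAŁABAN's `A = 0` OPERATOR**: `fineOpR p a 0 R = n²·fineOpR m 0 0 R + (a∕p^{d+1})·sameBlk p R` for `p = n·m`
(`fineOpR p a 0 = p²(−Δ^N_R) + (a∕p^{d+1})1_{same p-block}`, `fineOpR m 0 0 = m²(−Δ^N_R)`). [folklore] -/
theorem fineOpR_scale {p n m : ℕ} (hp : p = n * m) (a : ℝ) (R : Finset (Fin (d + 1) → ℤ)) :
    fineOpR p a 0 R = ((n : ℝ) ^ 2) • fineOpR m 0 0 R + (a * (((p : ℕ) : ℝ) ^ (d + 1))⁻¹) • sameBlk p R := by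
  ext x y
  simp only [fineOpR, regionOpR, sameBlk, Matrix.add_apply, Matrix.smul_apply, Matrix.of_apply, smul_eq_mul, diagK, avgK,
    hp, Nat.cast_mul]
  split_ifs <;> ring

/-- at mesh one and `a = 0` Bałaban's operator is the pure Neumann Laplacian of the region. [folklore] -/
theorem fineOpR_one_zero_apply (R : Finset (Fin (d + 1) → ℤ)) (x y : ↥R) :
    fineOpR 1 0 0 R x y = neumannLapR R x.1 y.1 := by
  simp only [fineOpR, regionOpR, Matrix.of_apply, diagK, avgK, Nat.cast_one, one_pow, one_mul, zero_mul]
  split_ifs <;> ring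

end SameBlk

/-! ### §2 Block column sums of the coordinate matrix -/

section ColumnSums

variable {L : ℕ} [NeZero L] {R' : Finset (Fin (d + 1) → ℤ)} (hR : IsBlockUnion L R')

/-- the block-mean column `inl b` of `T` sums to `L^{d+1}` over block `b` and to `0` over every other block. [folklore] -/
theorem sum_coordT_rchart_inl (b' b : ↥(R'.image (blk L))) :
    ∑ j : Fin (d + 1) → Fin L, coordT hR (rchart NeZero.one_le hR b' j) (Sum.inl b)
      = if b' = b then (L : ℝ) ^ (d + 1) else 0 := by
  simp only [coordT, Matrix.of_apply, rblk_rchart]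
  split_ifs with h
  · simp only [Finset.sum_const, Finset.card_univ, Fintype.card_pi, Fintype.card_fin, Finset.prod_const, nsmul_eq_mul,
      mul_one]
    push_cast
    rfl
  · simp

/-- **THE FLUCTUATION COLUMNS HAVE ZERO BLOCK SUMS**: `Σ_j T(rchart b′ j, inr (b, ν)) = 0`. [folklore] -/
theorem sum_coordT_rchart_inr (b' : ↥(R'.image (blk L))) (bj : ↥(R'.image (blk L)) × NZ d L) :
    ∑ j : Fin (d + 1) → Fin L, coordT hR (rchart NeZero.one_le hR b' j) (Sum.inr bj) = 0 := by
  classical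
  simp only [coordT, Matrix.of_apply, Finset.sum_sub_distrib]
  by_cases hb : b' = bj.1
  · subst hb
    have h2 : ∑ j : Fin (d + 1) → Fin L,
        (if rchart NeZero.one_le hR bj.1 j = rchart NeZero.one_le hR bj.1 0 then (1 : ℝ) else 0) = 1 := by
      rw [Finset.sum_eq_single (0 : Fin (d + 1) → Fin L) (fun j _ hj => if_neg (fun h => hj ((rchart_inj2 hR h).2)))
        (fun h => absurd (Finset.mem_univ _) h), if_pos rfl]
    have h1 : ∑ j : Fin (d + 1) → Fin L,
        (if rchart NeZero.one_le hR bj.1 j = rchart NeZero.one_le hR bj.1 bj.2.1 then (1 : ℝ) else 0) = 1 := by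
      rw [Finset.sum_eq_single (bj.2.1 : Fin (d + 1) → Fin L) (fun j _ hj => if_neg (fun h => hj ((rchart_inj2 hR h).2)))
        (fun h => absurd (Finset.mem_univ _) h), if_pos rfl]
    rw [h1, h2, sub_self]
  · have h1 : ∀ j : Fin (d + 1) → Fin L,
        (if rchart NeZero.one_le hR b' j = rchart NeZero.one_le hR bj.1 bj.2.1 then (1 : ℝ) else 0) = 0 := fun j =>
      if_neg (fun h => hb ((rchart_inj2 hR h).1))
    have h2 : ∀ j : Fin (d + 1) → Fin L,
        (if rchart NeZero.one_le hR b' j = rchart NeZero.one_le hR bj.1 0 then (1 : ℝ) else 0) = 0 := fun j =>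
      if_neg (fun h => hb ((rchart_inj2 hR h).1))
    simp [h1, h2]

/-- both column sums in one `match`. [folklore] -/
theorem sum_coordT_rchart (b' : ↥(R'.image (blk L))) (c : ↥(R'.image (blk L)) ⊕ (↥(R'.image (blk L)) × NZ d L)) :
    ∑ j : Fin (d + 1) → Fin L, coordT hR (rchart NeZero.one_le hR b' j) c
      = match c with
        | Sum.inl b => if b' = b then (L : ℝ) ^ (d + 1) else 0
        | Sum.inr _ => 0 := by
  rcases c with b | bj
  · exact sum_coordT_rchart_inl hR b' b
  · exact sum_coordT_rchart_inr hR b' bj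

end ColumnSums

/-! ### §3 Run B's averaging term in block coordinates -/

section Averaging

variable {n L : ℕ} [NeZero L] {R' : Finset (Fin (d + 1) → ℤ)} (hR : IsBlockUnion L R')

omit [NeZero L] in
/-- `1[same nL-block]` on the fine region is `1[same n-block]` of the `L`-block labels. [folklore] -/
theorem sameBlk_fine_apply (x x' : ↥R') :
    sameBlk (n * L) R' x x' = sameBlk n (R'.image (blk L)) (rblk L R' x) (rblk L R' x') := by
  simp only [sameBlk, Matrix.of_apply, rblk, Nat.mul_comm n L, ← blk_blk]

/-- the right half: `Σ_{x′} 1[same nL-block](x, x′)·T(x′, c) = L^{d+1}·[c = inl b]·1[blk_n b = blk_n (blk_L x)]`. [folklore] -/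
theorem sameBlk_mul_coordT_apply (x : ↥R') (c : ↥(R'.image (blk L)) ⊕ (↥(R'.image (blk L)) × NZ d L)) :
    (sameBlk (n * L) R' * coordT hR) x c
      = match c with
        | Sum.inl b => (L : ℝ) ^ (d + 1) * sameBlk n (R'.image (blk L)) (rblk L R' x) b
        | Sum.inr _ => 0 := by
  rw [Matrix.mul_apply, sum_eq_sum_blocks hR]
  simp_rw [sameBlk_fine_apply, rblk_rchart]
  have h : ∀ b' : ↥(R'.image (blk L)),
      ∑ j : Fin (d + 1) → Fin L, sameBlk n (R'.image (blk L)) (rblk L R' x) b' * coordT hR (rchart NeZero.one_le hR b' j) c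
        = sameBlk n (R'.image (blk L)) (rblk L R' x) b' * ∑ j : Fin (d + 1) → Fin L, coordT hR (rchart NeZero.one_le hR b' j) c :=
    fun b' => by rw [Finset.mul_sum]
  simp_rw [h, sum_coordT_rchart hR]
  rcases c with b | bj
  · simp only [mul_ite, mul_zero]
    rw [Finset.sum_ite_eq' Finset.univ b, if_pos (Finset.mem_univ _), mul_comm]
  · simp

/-- **RUN B's AVERAGING TERM IN BLOCK COORDINATES**: `Tᵀ·1[same nL-block]·T = L^{2(d+1)}·fromBlocks (1[same n-block]) 0 0 0` —
it acts on the block means only, and there it is run A's averaging indicator. [folklore] -/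
theorem coordT_sameBlk_coordT :
    (coordT hR)ᵀ * sameBlk (n * L) R' * coordT hR
      = (((L : ℝ) ^ (d + 1)) ^ 2) • Matrix.fromBlocks (sameBlk n (R'.image (blk L))) 0 0 0 := by
  ext c₁ c₂
  have key : ((coordT hR)ᵀ * sameBlk (n * L) R' * coordT hR) c₁ c₂
      = ∑ x, coordT hR x c₁ * (sameBlk (n * L) R' * coordT hR) x c₂ := by
    rw [Matrix.mul_assoc, Matrix.mul_apply]
    rfl
  rw [key]
  simp_rw [sameBlk_mul_coordT_apply hR]
  rcases c₂ with b₂ | bj₂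
  · -- second index a block mean
    rw [sum_eq_sum_blocks hR]
    have h : ∀ b' : ↥(R'.image (blk L)),
        ∑ j : Fin (d + 1) → Fin L, coordT hR (rchart NeZero.one_le hR b' j) c₁ *
            ((L : ℝ) ^ (d + 1) * sameBlk n (R'.image (blk L)) (rblk L R' (rchart NeZero.one_le hR b' j)) b₂)
          = (∑ j : Fin (d + 1) → Fin L, coordT hR (rchart NeZero.one_le hR b' j) c₁) *
            ((L : ℝ) ^ (d + 1) * sameBlk n (R'.image (blk L)) b' b₂) := by
      intro b'
      rw [Finset.sum_mul]
      refine Finset.sum_congr rfl fun j _ => ?_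
      rw [rblk_rchart]
    simp_rw [h, sum_coordT_rchart hR]
    rcases c₁ with b₁ | bj₁
    · have h1 : ∀ b' : ↥(R'.image (blk L)),
          (if b' = b₁ then (L : ℝ) ^ (d + 1) else 0) * ((L : ℝ) ^ (d + 1) * sameBlk n (R'.image (blk L)) b' b₂)
            = if b' = b₁ then (L : ℝ) ^ (d + 1) * ((L : ℝ) ^ (d + 1) * sameBlk n (R'.image (blk L)) b₁ b₂) else 0 := by
        intro b'
        split_ifs with hb
        · rw [hb]
        · rw [zero_mul]
      simp_rw [h1]
      rw [Finset.sum_ite_eq' Finset.univ b₁, if_pos (Finset.mem_univ _), Matrix.smul_apply, Matrix.fromBlocks_apply₁₁,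
        smul_eq_mul]
      ring
    · simp [Matrix.fromBlocks_apply₂₁]
  · -- second index a fluctuation: the column vanishes
    rcases c₁ with b₁ | bj₁
    · simp [Matrix.fromBlocks_apply₁₂]
    · simp [Matrix.fromBlocks_apply₂₂]

end Averaging

/-! ### §4 The two runs' operators: mesh scaling -/

section Runs

variable {n L : ℕ} [NeZero L] {R' : Finset (Fin (d + 1) → ℤ)}

/-- **RUN A**: `P_A(n, a) = n²·P_A(1, 0) + (a∕n^{d+1})·sameBlk n R`. [folklore] -/
theorem runA_eq (n L : ℕ) (a : ℝ) (R' : Finset (Fin (d + 1) → ℤ)) :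
    runA n L a R' = ((n : ℝ) ^ 2) • runA 1 L 0 R' + (a * ((n : ℝ) ^ (d + 1))⁻¹) • sameBlk n (R'.image (blk L)) := by
  unfold runA
  rw [fineOpR_scale (p := n) (n := n) (m := 1) (by simp) a]

/-- **RUN B IN BLOCK COORDINATES**: `H_B(n, a) = n²·H_B(1, 0) + fromBlocks ((a∕n^{d+1})·sameBlk n R) 0 0 0`. [folklore] -/
theorem runB_eq (hR : IsBlockUnion L R') (n : ℕ) (a : ℝ) :
    runB hR n a = ((n : ℝ) ^ 2) • runB hR 1 0
      + Matrix.fromBlocks ((a * ((n : ℝ) ^ (d + 1))⁻¹) • sameBlk n (R'.image (blk L))) 0 0 0 := by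
  have hL0 : (0 : ℝ) < L := by exact_mod_cast (NeZero.one_le : 1 ≤ L)
  have hLp : ((L : ℝ) ^ (d + 1)) ≠ 0 := by positivity
  unfold runB
  rw [fineOpR_scale (p := n * L) (n := n) (m := 1 * L) (by ring) a R', Matrix.mul_add, Matrix.add_mul, smul_add,
    Matrix.mul_smul, Matrix.smul_mul, smul_smul, Matrix.mul_smul, Matrix.smul_mul, smul_smul,
    coordT_sameBlk_coordT hR, smul_smul]
  congr 1
  · rw [smul_smul, mul_comm]
  · rw [Matrix.fromBlocks_smul]
    simp only [smul_zero]
    have hc : ((L : ℝ) ^ (d + 1))⁻¹ * (a * ((((n * L : ℕ)) : ℝ) ^ (d + 1))⁻¹) * ((L : ℝ) ^ (d + 1)) ^ 2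
        = a * ((n : ℝ) ^ (d + 1))⁻¹ := by
      push_cast
      rw [mul_pow]
      field_simp
    rw [hc]

/-- the four blocks of run B scale accordingly: the mean–mean block carries the averaging term … [folklore] -/
theorem runB_toBlocks₁₁ (hR : IsBlockUnion L R') (n : ℕ) (a : ℝ) :
    (runB hR n a).toBlocks₁₁ = ((n : ℝ) ^ 2) • (runB hR 1 0).toBlocks₁₁
      + (a * ((n : ℝ) ^ (d + 1))⁻¹) • sameBlk n (R'.image (blk L)) := by
  conv_lhs => rw [runB_eq hR n a]
  ext i j; simp [Matrix.toBlocks₁₁]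

/-- … and the three other blocks do not. [folklore] -/
theorem runB_toBlocks₁₂ (hR : IsBlockUnion L R') (n : ℕ) (a : ℝ) :
    (runB hR n a).toBlocks₁₂ = ((n : ℝ) ^ 2) • (runB hR 1 0).toBlocks₁₂ := by
  conv_lhs => rw [runB_eq hR n a]
  ext i j; simp [Matrix.toBlocks₁₂]

/-- [folklore] -/
theorem runB_toBlocks₂₁ (hR : IsBlockUnion L R') (n : ℕ) (a : ℝ) :
    (runB hR n a).toBlocks₂₁ = ((n : ℝ) ^ 2) • (runB hR 1 0).toBlocks₂₁ := by
  conv_lhs => rw [runB_eq hR n a]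
  ext i j; simp [Matrix.toBlocks₂₁]

/-- [folklore] -/
theorem runB_toBlocks₂₂ (hR : IsBlockUnion L R') (n : ℕ) (a : ℝ) :
    (runB hR n a).toBlocks₂₂ = ((n : ℝ) ^ 2) • (runB hR 1 0).toBlocks₂₂ := by
  conv_lhs => rw [runB_eq hR n a]
  ext i j; simp [Matrix.toBlocks₂₂]

end Runs

/-! ### §5 The line Laplacian and the decomposition of the two-cutoff line -/

section Line

variable {n L : ℕ} [NeZero L] {R' : Finset (Fin (d + 1) → ℤ)}

/-- **THE LINE LAPLACIAN** `lineLap(s) = (1−s)·(−Δ^N_R) + s·Schur_ψ(L^{−(d+1)}·Tᵀ·L²(−Δ^N_{R′})·T)`: the two-cutoff line at mesh one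
WITHOUT the averaging term — the `s`-interpolation of run A's Neumann Laplacian and the hard block-mean Schur complement `K_L` of
run B's Laplacian. [folklore] -/
def lineLap (hR : IsBlockUnion L R') (s : ℝ) : Matrix ↥(R'.image (blk L)) ↥(R'.image (blk L)) ℝ :=
  twoCutoffLine hR 1 0 s

/-- `lineLap` unfolded. [folklore] -/
theorem lineLap_eq (hR : IsBlockUnion L R') (s : ℝ) : lineLap hR s = twoCutoffLine hR 1 0 s := rfl

/-- the line Laplacian is symmetric. [folklore] -/
theorem lineLap_isSymm (hR : IsBlockUnion L R') (s : ℝ) : (lineLap hR s).IsSymm :=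
  twoCutoffLine_isSymm hR 1 0 s

omit [NeZero L] in
/-- a unit region is a union of `1·L`-blocks iff of `L`-blocks (bookkeeping for file 33's lemma at mesh one). [folklore] -/
theorem isBlockUnion_one_mul (hR : IsBlockUnion L R') : IsBlockUnion (1 * L) R' := by
  rwa [one_mul]

/-- `(c·A)⁻¹ = c⁻¹·A⁻¹` for `c ≠ 0` and `A` invertible. [folklore] -/
theorem inv_smul_of_isUnit {ι : Type*} [Fintype ι] [DecidableEq ι] {A : Matrix ι ι ℝ} (hA : IsUnit A.det) {c : ℝ}
    (hc : c ≠ 0) : (c • A)⁻¹ = c⁻¹ • A⁻¹ :=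
  Matrix.inv_eq_left_inv (by
    rw [Matrix.smul_mul, Matrix.mul_smul, smul_smul, Matrix.nonsing_inv_mul _ hA, inv_mul_cancel₀ hc, one_smul])

/-- **THE DECOMPOSITION OF THE TWO-CUTOFF LINE**: for `n ≥ 1`, `R′` a union of `nL`-blocks, every `a` and `s`,
`twoCutoffLine(n, a, s) = n²·lineLap(s) + (a∕n^{d+1})·sameBlk n R` — the averaging term of both runs is the same and has no
fluctuation components, so it passes through the Schur complement additively; what is left scales like a Laplacian. [folklore] -/
theorem twoCutoffLine_eq_lineLap (hn : 1 ≤ n) (hR' : IsBlockUnion (n * L) R') (a s : ℝ) :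
    twoCutoffLine (isBlockUnion_fine hR') n a s
      = ((n : ℝ) ^ 2) • lineLap (isBlockUnion_fine hR') s
        + (a * ((n : ℝ) ^ (d + 1))⁻¹) • sameBlk n (R'.image (blk L)) := by
  have hn0 : ((n : ℝ) ^ 2) ≠ 0 := by positivity
  -- the fluctuation block at mesh one, `a = 0`, is invertible (file 33)
  have hD : IsUnit ((runB (isBlockUnion_fine hR') 1 0).toBlocks₂₂).det :=
    isUnit_det_runB_fluct (L := L) (le_refl 1) (isBlockUnion_one_mul (isBlockUnion_fine hR')) (le_refl (0 : ℝ))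
  have hSchur : ((n : ℝ) ^ 2 • (runB (isBlockUnion_fine hR') 1 0).toBlocks₁₂)
        * ((n : ℝ) ^ 2 • (runB (isBlockUnion_fine hR') 1 0).toBlocks₂₂)⁻¹
        * ((n : ℝ) ^ 2 • (runB (isBlockUnion_fine hR') 1 0).toBlocks₂₁)
      = (n : ℝ) ^ 2 • ((runB (isBlockUnion_fine hR') 1 0).toBlocks₁₂ * ((runB (isBlockUnion_fine hR') 1 0).toBlocks₂₂)⁻¹
          * (runB (isBlockUnion_fine hR') 1 0).toBlocks₂₁) := by
    rw [inv_smul_of_isUnit hD hn0]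
    simp only [Matrix.smul_mul, Matrix.mul_smul, smul_smul]
    congr 1
    field_simp
  rw [lineLap, twoCutoffLine, twoCutoffLine, lineOpR, lineOpR, runA_eq n L a R', runB_toBlocks₁₁ _ n a,
    runB_toBlocks₁₂ _ n a, runB_toBlocks₂₁ _ n a, runB_toBlocks₂₂ _ n a, hSchur]
  module

/-- **TRANSPORT ALONG AN EQUALITY OF FINE REGIONS**: the entries of `lineLap` depend only on the lattice points and on `R′` as a set.
[folklore] -/
theorem lineLap_congr {R'₁ R'₂ : Finset (Fin (d + 1) → ℤ)} (h : R'₁ = R'₂) (h₁ : IsBlockUnion L R'₁) (h₂ : IsBlockUnion L R'₂)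
    (s : ℝ) (x y : ↥(R'₁.image (blk L))) :
    lineLap h₁ s x y = lineLap h₂ s ⟨x.1, h ▸ x.2⟩ ⟨y.1, h ▸ y.2⟩ := by
  subst h
  rfl

end Line

/-! ### §6 On b04's box index: `boxLine = n²·boxLap + a·P_n` -/

section Box

variable {n : ℕ} (L : ℕ) [NeZero L] {M : Fin (d + 1) → ℕ}

/-- **THE BOX LINE LAPLACIAN** on b04's index `↥(boxDom (n·M))`: the reindexed `lineLap` of the Neumann box `boxDom (nL·M)`. [folklore] -/
def boxLap (hn : 1 ≤ n) (M : Fin (d + 1) → ℕ) (s : ℝ) :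
    Matrix ↥(boxDom fun i => n * M i) ↥(boxDom fun i => n * M i) ℝ :=
  Matrix.reindex (boxEquiv n L M) (boxEquiv n L M)
    (lineLap (isBlockUnion_fine (fineBox_isBlockUnion hn (NeZero.one_le : 1 ≤ L) M)) s)

/-- the box line Laplacian is symmetric. [folklore] -/
theorem boxLap_isSymm (hn : 1 ≤ n) (s : ℝ) : (boxLap L hn M s).IsSymm := by
  unfold boxLap
  rw [Matrix.reindex_apply]
  exact (lineLap_isSymm _ s).submatrix _

/-- the reindexed same-block indicator is b04's block projection up to the factor `n^{d+1}`:
`(a∕n^{d+1})·reindex (sameBlk n) = a·Pmat n`. [folklore] -/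
theorem reindex_sameBlk (a : ℝ) :
    (a * ((n : ℝ) ^ (d + 1))⁻¹) •
        Matrix.reindex (boxEquiv n L M) (boxEquiv n L M) (sameBlk n ((boxDom fun i => n * L * M i).image (blk L)))
      = a • Pmat n (fun i => n * M i) := by
  ext x y
  simp only [Matrix.smul_apply, Matrix.reindex_apply, Matrix.submatrix_apply, sameBlk, Pmat, Matrix.of_apply, smul_eq_mul]
  have hx : ((boxEquiv n L M).symm x).1 = x.1 := rfl
  have hy : ((boxEquiv n L M).symm y).1 = y.1 := rfl
  rw [hx, hy]
  split_ifs <;> simp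

/-- **`boxLine = n²·boxLap + a·P_n`** — the box line is the rescaled line Laplacian plus the averaging projection. [folklore] -/
theorem boxLine_eq_boxLap (hn : 1 ≤ n) (a s : ℝ) :
    boxLine L hn M a s = ((n : ℝ) ^ 2) • boxLap L hn M s + a • Pmat n (fun i => n * M i) := by
  rw [boxLine, twoCutoffLine_eq_lineLap hn (fineBox_isBlockUnion hn (NeZero.one_le : 1 ≤ L) M) a s, ← reindex_sameBlk L a,
    boxLap]
  simp only [Matrix.reindex_apply, Matrix.submatrix_add, Matrix.submatrix_smul]
  rfl

/-- entries of `boxLap` through `lineLap`. [folklore] -/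
theorem boxLap_apply (hn : 1 ≤ n) (s : ℝ) (x y : ↥(boxDom fun i => n * M i)) :
    boxLap L hn M s x y
      = lineLap (isBlockUnion_fine (fineBox_isBlockUnion hn (NeZero.one_le : 1 ≤ L) M)) s ((boxEquiv n L M).symm x)
          ((boxEquiv n L M).symm y) := rfl

/-- **TRANSPORT**: the entries of `boxLap` depend only on the lattice points and on the fine box AS A SET — two presentations
`(n, M)`, `(n′, M′)` of the same fine box `boxDom (nL·M) = boxDom (n′L·M′)` give the same entries. [folklore] -/
theorem boxLap_apply_congr {n n' : ℕ} (hn : 1 ≤ n) (hn' : 1 ≤ n') {M M' : Fin (d + 1) → ℕ}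
    (hR : (boxDom fun i => n * L * M i) = (boxDom fun i => n' * L * M' i)) (s : ℝ)
    (x y : ↥(boxDom fun i => n * M i)) (x' y' : ↥(boxDom fun i => n' * M' i)) (hx : x.1 = x'.1) (hy : y.1 = y'.1) :
    boxLap L hn M s x y = boxLap L hn' M' s x' y' := by
  rw [boxLap_apply, boxLap_apply,
    lineLap_congr hR _ (isBlockUnion_fine (fineBox_isBlockUnion hn' (NeZero.one_le : 1 ≤ L) M')) s]
  congr 1
  · exact Subtype.ext hx
  · exact Subtype.ext hy

end Box

end Summit.QuantumFields.BalabanUV.T4Continuum.NE7K1LinLineLaplacian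

end
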